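import Summits.AnomalousDissipation.AnomalousDissipation.Theorems.SawtoothPulseCascadeK1LocalisedCascadeSlotFibreMax
import Literature.Analysis.FluidPDE.TorusHeatForcedIcc

/-!
# K1loc, line `Spectral` / SeqCone — helper: THE PER-FIBRE ESTIMATE FOR ONE STRIP FAMILY (S-B assembly, step 2)

Helper file of the prover lane on the crux `K1LocalisedCascade` (stmt-AnomalousDissipation-19491), route
`SawtoothPulseCascade` (companion of `…K1LocalisedCascadeFibreFactor`).  The energy ledger runs ONE strip family per
tracked-family step (`…K1Slot.sqrt_tsum_symbol_sq_family_step_H/_V` with the second cut-off the zero profile `Z`), so the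
per-fibre un-gauging estimate it consumes is `…K1Slot.tsum_symbol_sq_twoStrip_fibre_le_max` (SlotFibreMax) with `X⁻ := Z`.
This file performs that specialisation once and for all (`fibre_estimate_one_family`): with `X⁻ = 0` the second derivative
family is the zero function, its bounds `B⁻_α = 0`, the disjointness `conj(Θ⁺_α)·Θ⁻ = 0` and the summabilities of the `X⁻`
spectrum are automatic, the second branch shift is taken equal to the first, and the conclusion collapses to the ONE-family
shape `Σ' m²|𝓕((X(x_j)+Z(x_j))·G∘Φ_P)|² ≤ (√Σ' μ²|𝓕G|² + A‖G‖)² + 2C‖G‖²`,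
`A = Σ_{1≤α<r} B_α M_α + L·Σ_q ρ(q)‖𝓕Θ(q)‖`, `C = L₂·Σ_q ρ₂(q)‖𝓕Θ(q)‖`, `Θ(x) = X(x_j)·twist P n (x_j)·e_b(x)` — exactly the
hypothesis `hfibP` of `…K1Ledger.fibre_estimate_of_split` / `hfib` of the family steps (for the exact-flat profile `P`).
What remains abstract here (sockets for the S-B data files): the derivative multipliers `Θ_α` of `Θ` with sup bounds `B_α`
(`…SlotMultiplierData` + `…MultiplierConstants`), the branch compatibility `m(k − b e_j)² ≤ μ(k)²` on the fibre
(`…SymbolCone`/`…SymbolLattice`), the Taylor data `μ_α, ν_α, L, L₂, ρ, ρ₂` of the fibre symbols (`…SlotTaylorSymbol` +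
`…SymbolFibreDataH/V`) and the spectral moments `Σρ|𝓕Θ|`, `Σρ₂|𝓕Θ|` (`…SlotWienerBound`/`…SpectralMoments`).
No definitions; no statement about the stub.
[cite: Grafakos2014, Prop. 3.1.2 (5) and Prop. 3.2.7 (3)] [problem: turb]
-/

-- `Summit.<Summit>.<Problem>`: single-conjunct summit, the duplicate namespace segment is deliberate.
set_option linter.dupNamespace false

noncomputable section

namespace Summit.AnomalousDissipation.AnomalousDissipation.Theorems.SawtoothPulseCascade.K1Ledger

open MeasureTheory Set Filter Topology UnitAddTorus Complex
open scoped ComplexConjugate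
open Literature.Analysis Literature.Analysis.FunctionSpaces Literature.Analysis.FunctionSpaces.Torus
open Summit.AnomalousDissipation.AnomalousDissipation.Theorems.SawtoothPulseCascade.SpectralLeakage
open Summit.AnomalousDissipation.AnomalousDissipation.Theorems.SawtoothPulseCascade.K1Slot

variable {d : Type*} [Fintype d] [DecidableEq d]

/-- The un-gauging multiplier of the ZERO profile vanishes identically. [folklore] -/
theorem ungaugeMultiplier_zero_profile (P Z : ShearProfile) (hZ : ∀ y, Z y = 0) (n b : ℤ) (j : d) (x : UnitAddTorus d) :
    (Z.onCircle (x j) : ℂ) * twist P n (x j) * mFourier (Pi.single j b) x = 0 := by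
  obtain ⟨y, hy⟩ := QuotientAddGroup.mk_surjective (x j)
  rw [← hy, ShearProfile.onCircle_coe, hZ, Complex.ofReal_zero, zero_mul, zero_mul]

/-- **The per-fibre estimate for ONE strip family** (`…K1Slot.tsum_symbol_sq_twoStrip_fibre_le_max` with the second cut-off
the zero profile).  Data on the fibre `k_i = n` (`i ≠ j`): an un-gauging profile `P`, a strip cut-off `X` with `|X| ≤ 1`, a
zero profile `Z`, a branch shift `b`; the derivative multipliers `Θ_α` (`α < r`, `0 < r`) of
`Θ(x) = X(x_j)·twist P n (x_j)·e_b(x)` — continuous, with summable spectra, `𝓕Θ_α = (2πi q_j)^α 𝓕Θ`, `Θ_0 = Θ`, `‖Θ_α‖ ≤ B_α`;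
the new symbol `m` with fibre version `m_n` (`|m_n| ≤ M`), the old symbol `μ` with fibre version `μ_n` (`|μ_n| ≤ M_μ`), the
branch compatibility `m(k − b e_j)² ≤ μ(k)²` on the fibre; Taylor data `μ_α` (`μ_0 = μ_n`, `‖μ_α‖ ≤ M_α`) with remainder
`L·ρ` on the spectrum of `Θ`, and `ν_α` (`‖ν_α‖ ≤ M_d`) for the squared shifted new symbol with remainder `L₂·ρ₂`; summable
moments `Σρ|𝓕Θ|`, `Σρ₂|𝓕Θ|`.  Then for every smooth `G` on the fibre:
`Σ' m²|𝓕((X(x_j)+Z(x_j))·G(Φ_P x))|² ≤ (√Σ' μ²|𝓕G|² + A·√∫‖G‖²)² + 2C·∫‖G‖²`,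
`A = Σ_{1≤α<r} B_α M_α + L Σρ|𝓕Θ|`, `C = L₂ Σρ₂|𝓕Θ|`. [cite: Grafakos2014, Prop. 3.1.2 (5) and Prop. 3.2.7 (3)] -/
theorem fibre_estimate_one_family {G : UnitAddTorus d → ℂ} {i j : d} (hG : IsSmooth G)
    (hij : i ≠ j) {n : ℤ} (hn : ∀ k, mFourierCoeff G k ≠ 0 → k i = n) (P X Z : ShearProfile)
    (hX1 : ∀ y, |X y| ≤ 1) (hZ : ∀ y, Z y = 0) (b : ℤ)
    {r : ℕ} (hr : 0 < r)
    {Θd : ℕ → UnitAddTorus d → ℂ} (hΘd_c : ∀ α ∈ Finset.range r, Continuous (Θd α))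
    (hΘd_s : ∀ α ∈ Finset.range r, Summable fun q => ‖mFourierCoeff (Θd α) q‖)
    (hΘd : ∀ α ∈ Finset.range r, ∀ q, mFourierCoeff (Θd α) q = (2 * Real.pi * I * (q j : ℂ)) ^ α *
      mFourierCoeff (fun x : UnitAddTorus d => (X.onCircle (x j) : ℂ) * twist P n (x j) * mFourier (Pi.single j b) x) q)
    (hΘd0 : Θd 0 = fun x : UnitAddTorus d => (X.onCircle (x j) : ℂ) * twist P n (x j) * mFourier (Pi.single j b) x)
    {B : ℕ → ℝ} (hB : ∀ α ∈ Finset.range r, ∀ x, ‖Θd α x‖ ≤ B α)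
    {m mn : (d → ℤ) → ℝ} (hmn : ∀ k, k i = n → mn k = m k) {M : ℝ} (hmnM : ∀ k, |mn k| ≤ M)
    {μ μn : (d → ℤ) → ℝ} (hμn : ∀ k, k i = n → μn k = μ k) {Mμ : ℝ} (hμnM : ∀ k, |μn k| ≤ Mμ)
    (hcomp : ∀ k : d → ℤ, k i = n → m (k - Pi.single j b) ^ 2 ≤ μ k ^ 2)
    {μd νd : ℕ → (d → ℤ) → ℂ} (hμd0 : ∀ k, μd 0 k = (μn k : ℂ)) {Mα : ℕ → ℝ}
    (hMα : ∀ α ∈ Finset.range r, ∀ k, ‖μd α k‖ ≤ Mα α) {Md : ℝ} (hνd : ∀ α ∈ Finset.range r, ∀ k, ‖νd α k‖ ≤ Md)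
    {ρ ρ₂ : (d → ℤ) → ℝ} {L L₂ : ℝ} (hρ0 : ∀ q, 0 ≤ ρ q) (hρ₂0 : ∀ q, 0 ≤ ρ₂ q) (hL : 0 ≤ L) (hL₂ : 0 ≤ L₂)
    (hT : ∀ k q, mFourierCoeff (fun x : UnitAddTorus d => (X.onCircle (x j) : ℂ) * twist P n (x j) *
        mFourier (Pi.single j b) x) q ≠ 0 →
      ‖(μn k : ℂ) - ∑ α ∈ Finset.range r, (2 * Real.pi * I * (q j : ℂ)) ^ α * μd α (k - q)‖ ≤ L * ρ q)
    (hT₂ : ∀ k q, mFourierCoeff (fun x : UnitAddTorus d => (X.onCircle (x j) : ℂ) * twist P n (x j) *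
        mFourier (Pi.single j b) x) q ≠ 0 →
      ‖((mn (k + Pi.single j (-b)) ^ 2 : ℝ) : ℂ) - ∑ α ∈ Finset.range r, (2 * Real.pi * I * (q j : ℂ)) ^ α * νd α (k - q)‖ ≤
        L₂ * ρ₂ q)
    (hρs : Summable fun q => ρ q * ‖mFourierCoeff (fun x : UnitAddTorus d => (X.onCircle (x j) : ℂ) * twist P n (x j) *
        mFourier (Pi.single j b) x) q‖)
    (hρ₂s : Summable fun q => ρ₂ q * ‖mFourierCoeff (fun x : UnitAddTorus d => (X.onCircle (x j) : ℂ) * twist P n (x j) *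
        mFourier (Pi.single j b) x) q‖) :
    ∑' k, m k ^ 2 * ‖mFourierCoeff (fun x => ((X.onCircle (x j) : ℂ) + Z.onCircle (x j)) * G (shearMap i j P x)) k‖ ^ 2 ≤
      (Real.sqrt (∑' k, μ k ^ 2 * ‖mFourierCoeff G k‖ ^ 2) +
          (∑ α ∈ Finset.Ico 1 r, B α * Mα α + L * ∑' q, ρ q * ‖mFourierCoeff (fun x : UnitAddTorus d =>
              (X.onCircle (x j) : ℂ) * twist P n (x j) * mFourier (Pi.single j b) x) q‖) *
            Real.sqrt (∫ x, ‖G x‖ ^ 2)) ^ 2 +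
        2 * (L₂ * ∑' q, ρ₂ q * ‖mFourierCoeff (fun x : UnitAddTorus d =>
            (X.onCircle (x j) : ℂ) * twist P n (x j) * mFourier (Pi.single j b) x) q‖) * ∫ x, ‖G x‖ ^ 2 := by
  -- the second family is the zero profile: its multiplier and derivative multipliers vanish
  have hZm : (fun x : UnitAddTorus d => (Z.onCircle (x j) : ℂ) * twist P n (x j) * mFourier (Pi.single j b) x) =
      fun _ => (0 : ℂ) := by
    funext x; exact ungaugeMultiplier_zero_profile P Z hZ n b j x
  have hZcoef : ∀ q, mFourierCoeff (fun x : UnitAddTorus d => (Z.onCircle (x j) : ℂ) * twist P n (x j) *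
      mFourier (Pi.single j b) x) q = 0 := fun q => by rw [hZm]; exact FluidPDE.Torus.mFourierCoeff_zero_fun q
  have hXm1 : ∀ y, |Z y| ≤ 1 := fun y => by rw [hZ]; norm_num
  have hpart : ∀ y, X y ^ 2 + Z y ^ 2 ≤ 1 := fun y => by
    rw [hZ]; have h := hX1 y; rw [← sq_abs]; nlinarith [abs_nonneg (X y)]
  -- the zero derivative family
  set Θmd : ℕ → UnitAddTorus d → ℂ := fun _ x => (Z.onCircle (x j) : ℂ) * twist P n (x j) * mFourier (Pi.single j b) x
    with hΘmd_def
  have hΘmd_zero : ∀ α, Θmd α = fun _ => (0 : ℂ) := fun α => by rw [hΘmd_def]; exact hZm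
  have hΘmd_c : ∀ α ∈ Finset.range r, Continuous (Θmd α) := fun α _ => by rw [hΘmd_zero α]; exact continuous_const
  have hΘmd_s : ∀ α ∈ Finset.range r, Summable fun q => ‖mFourierCoeff (Θmd α) q‖ := fun α _ => by
    simp_rw [hΘmd_zero α, FluidPDE.Torus.mFourierCoeff_zero_fun, norm_zero]; exact summable_zero
  have hΘmd : ∀ α ∈ Finset.range r, ∀ q, mFourierCoeff (Θmd α) q = (2 * Real.pi * I * (q j : ℂ)) ^ α *
      mFourierCoeff (fun x : UnitAddTorus d => (Z.onCircle (x j) : ℂ) * twist P n (x j) * mFourier (Pi.single j b) x) q :=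
    fun α _ q => by rw [hΘmd_zero α, FluidPDE.Torus.mFourierCoeff_zero_fun, hZcoef, mul_zero]
  have hΘmd0 : Θmd 0 = fun x : UnitAddTorus d => (Z.onCircle (x j) : ℂ) * twist P n (x j) * mFourier (Pi.single j b) x :=
    rfl
  have hBm : ∀ α ∈ Finset.range r, ∀ x, ‖Θmd α x‖ ≤ (fun _ => (0 : ℝ)) α := fun α _ x => by
    rw [hΘmd_zero α]; simp
  have hdis : ∀ α ∈ Finset.range r, ∀ x, conj (Θd α x) *
      ((Z.onCircle (x j) : ℂ) * twist P n (x j) * mFourier (Pi.single j b) x) = 0 := fun α _ x => by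
    rw [ungaugeMultiplier_zero_profile P Z hZ n b j x, mul_zero]
  -- Taylor data on the joint spectrum (the `Z` part is empty)
  have hT' : ∀ k q, mFourierCoeff (fun x : UnitAddTorus d => (X.onCircle (x j) : ℂ) * twist P n (x j) *
        mFourier (Pi.single j b) x) q ≠ 0 ∨ mFourierCoeff (fun x : UnitAddTorus d => (Z.onCircle (x j) : ℂ) *
        twist P n (x j) * mFourier (Pi.single j b) x) q ≠ 0 →
      ‖(μn k : ℂ) - ∑ α ∈ Finset.range r, (2 * Real.pi * I * (q j : ℂ)) ^ α * μd α (k - q)‖ ≤ L * ρ q := by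
    intro k q hq
    rcases hq with hq | hq
    · exact hT k q hq
    · exact absurd (hZcoef q) hq
  have hρm : Summable fun q => ρ q * ‖mFourierCoeff (fun x : UnitAddTorus d => (Z.onCircle (x j) : ℂ) * twist P n (x j) *
      mFourier (Pi.single j b) x) q‖ := by
    simp_rw [hZcoef, norm_zero, mul_zero]; exact summable_zero
  -- the two-strip estimate
  have h := tsum_symbol_sq_twoStrip_fibre_le_max hG hij hn P X Z hXm1 hpart b b hr hΘd_c hΘd_s hΘd hΘd0 hΘmd_c hΘmd_s
    hΘmd hΘmd0 hB hBm hdis hmn hmnM hμn hμnM hcomp hcomp hμd0 hMα hνd hρ0 hρ₂0 hL hL₂ hT' hT₂ hρs hρm hρ₂s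
  -- collapse the vanishing second-family constant
  have hAm : ∑ α ∈ Finset.Ico 1 r, (fun _ => (0 : ℝ)) α * Mα α + L * ∑' q, ρ q *
      ‖mFourierCoeff (fun x : UnitAddTorus d => (Z.onCircle (x j) : ℂ) * twist P n (x j) * mFourier (Pi.single j b) x) q‖ =
      0 := by
    simp_rw [hZcoef, norm_zero, mul_zero, tsum_zero, mul_zero, zero_mul, Finset.sum_const_zero, add_zero]
  rw [hAm] at h
  have hA0 : 0 ≤ ∑ α ∈ Finset.Ico 1 r, B α * Mα α + L * ∑' q, ρ q * ‖mFourierCoeff (fun x : UnitAddTorus d =>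
      (X.onCircle (x j) : ℂ) * twist P n (x j) * mFourier (Pi.single j b) x) q‖ := by
    refine add_nonneg (Finset.sum_nonneg fun α hα => ?_) (mul_nonneg hL (tsum_nonneg fun q =>
      mul_nonneg (hρ0 q) (norm_nonneg _)))
    have hα' : α ∈ Finset.range r := Finset.mem_range.2 (Finset.mem_Ico.1 hα).2
    obtain ⟨x⟩ : Nonempty (UnitAddTorus d) := ⟨0⟩
    exact mul_nonneg ((norm_nonneg _).trans (hB α hα' x)) ((norm_nonneg _).trans (hMα α hα' 0))
  rwa [show (∑ α ∈ Finset.Ico 1 r, B α * Mα α + L * ∑' q, ρ q * ‖mFourierCoeff (fun x : UnitAddTorus d =>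
      (X.onCircle (x j) : ℂ) * twist P n (x j) * mFourier (Pi.single j b) x) q‖) ^ 2 + (0 : ℝ) ^ 2 =
      (∑ α ∈ Finset.Ico 1 r, B α * Mα α + L * ∑' q, ρ q * ‖mFourierCoeff (fun x : UnitAddTorus d =>
      (X.onCircle (x j) : ℂ) * twist P n (x j) * mFourier (Pi.single j b) x) q‖) ^ 2 by ring,
    Real.sqrt_sq hA0] at h

end Summit.AnomalousDissipation.AnomalousDissipation.Theorems.SawtoothPulseCascade.K1Ledger
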